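import Mathlib
import HarnessLib

/-!
# Fading of a one-signed part along a pointwise-convergent sequence (tool for the door zooms
  `ImplosionDoor.ImplosionZoom`, item stmt-NavierStokesRegularity-25308, and
  `HalfSpaceWindowDoor.HalfSpaceZoom`, item 25312)

**Lemma (`nonpos_of_fading_posPart`).** Let `F_j : ℝ³ → ℝ` be measurable functions converging
pointwise to a continuous `g`, and suppose the positive parts fade in mean square on every ball:
`∫_{B_R} (max(F_j, 0))² → 0` for every `R > 0`. Then `g ≤ 0` everywhere.

PROOF. Fatou (`lintegral_liminf_le'`) with the continuous map `x ↦ (max(x,0))²` gives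
`∫_{B_R} (max(g,0))² ≤ liminf_j ∫_{B_R} (max(F_j,0))² = 0`, so `(max(g,0))² = 0` a.e. on every
ball; if `g(y₀) > 0` then `(max(g,0))² > 0` on a small ball around `y₀`, which has positive
measure and lies in some `B_R` — contradiction. The `min`-version (`nonneg_of_fading_negPart`)
follows by `F ↦ −F`.

Route-independent (no `Theses` import); used by the two zoom supports with `F_j` the rescaled
radial velocity functional, resp. the rescaled `e`-vorticity, along the zoom times.

HONEST FRAMING: measure-theoretic plumbing; nothing here bears on Navier–Stokes regularity.
-/

noncomputable section

set_option linter.dupNamespace false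

namespace Summit.NavierStokesRegularity.NavierStokesRegularity.Theorems

open MeasureTheory Set Filter Topology Metric Function
open scoped ENNReal

namespace ZoomFading

/-- **Fading positive parts force a nonpositive pointwise limit.** [folklore] -/
theorem nonpos_of_fading_posPart {F : ℕ → EuclideanSpace ℝ (Fin 3) → ℝ}
    {g : EuclideanSpace ℝ (Fin 3) → ℝ} (hg : Continuous g)
    (hF : ∀ j, Measurable (F j))
    (hlim : ∀ y, Tendsto (fun j => F j y) atTop (𝓝 (g y)))
    (hfade : ∀ R : ℝ, 0 < R → Tendsto (fun j => ∫⁻ y in ball (0 : EuclideanSpace ℝ (Fin 3)) R,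
      ENNReal.ofReal ((max (F j y) 0) ^ 2)) atTop (𝓝 0)) :
    ∀ y, g y ≤ 0 := by
  -- the continuous functional `φ(x) = (max(x,0))²`
  set φ : ℝ → ℝ≥0∞ := fun x => ENNReal.ofReal ((max x 0) ^ 2) with hφ
  have hφc : Continuous φ :=
    ENNReal.continuous_ofReal.comp ((continuous_id.max continuous_const).pow 2)
  -- Fatou on every ball: `∫_{B_R} φ(g) = 0`
  have hball : ∀ R : ℝ, 0 < R →
      ∫⁻ y in ball (0 : EuclideanSpace ℝ (Fin 3)) R, φ (g y) = 0 := by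
    intro R hR
    refine le_antisymm ?_ bot_le
    have hlim' : ∀ y, liminf (fun j => φ (F j y)) atTop = φ (g y) := fun y =>
      ((hφc.tendsto _).comp (hlim y)).liminf_eq
    have hmeas : ∀ j, AEMeasurable (fun y => φ (F j y))
        (volume.restrict (ball (0 : EuclideanSpace ℝ (Fin 3)) R)) := fun j =>
      (hφc.measurable.comp (hF j)).aemeasurable
    calc ∫⁻ y in ball (0 : EuclideanSpace ℝ (Fin 3)) R, φ (g y)
        = ∫⁻ y in ball (0 : EuclideanSpace ℝ (Fin 3)) R, liminf (fun j => φ (F j y)) atTop := by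
          simp_rw [hlim']
      _ ≤ liminf (fun j => ∫⁻ y in ball (0 : EuclideanSpace ℝ (Fin 3)) R, φ (F j y)) atTop :=
          lintegral_liminf_le' hmeas
      _ = 0 := (hfade R hR).liminf_eq
  -- suppose `g y₀ > 0`
  intro y₀
  by_contra hpos
  push Not at hpos
  -- `φ ∘ g > 0` on a ball around `y₀`
  have hev : ∀ᶠ y in 𝓝 y₀, 0 < g y := (hg.tendsto y₀).eventually (lt_mem_nhds hpos)
  obtain ⟨δ, hδ, hδball⟩ := Metric.eventually_nhds_iff.1 hev
  set R : ℝ := ‖y₀‖ + δ + 1 with hRdef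
  have hR : 0 < R := by positivity
  have hsub : ball y₀ δ ⊆ ball (0 : EuclideanSpace ℝ (Fin 3)) R := by
    intro y hy
    rw [mem_ball, dist_zero_right]
    rw [mem_ball, dist_eq_norm] at hy
    have := norm_le_norm_add_norm_sub' y y₀
    rw [hRdef]
    linarith [norm_sub_rev y y₀]
  -- the zero integral on `B_R` forces `φ ∘ g = 0` a.e. there
  have hae : ∀ᵐ y ∂(volume.restrict (ball (0 : EuclideanSpace ℝ (Fin 3)) R)), φ (g y) = 0 :=
    (lintegral_eq_zero_iff' (hφc.measurable.comp hg.measurable).aemeasurable).1 (hball R hR)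
  rw [ae_restrict_iff' measurableSet_ball] at hae
  -- but the ball `B(y₀, δ)` has positive measure and `φ ∘ g ≠ 0` on it
  have hzero : volume (ball y₀ δ) = 0 := by
    refine measure_mono_null (fun y hy => ?_) (ae_iff.1 hae)
    simp only [mem_setOf_eq]
    intro himp
    have hgy : 0 < g y := hδball hy
    have hsq : 0 < (max (g y) 0) ^ 2 := by positivity
    have h0 := himp (hsub hy)
    simp only [hφ, ENNReal.ofReal_eq_zero] at h0
    exact absurd h0 (not_le.2 hsq)
  exact absurd hzero (measure_ball_pos volume y₀ hδ).ne'

/-- **Fading negative parts force a nonnegative pointwise limit** (the `min` version). [folklore] -/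
theorem nonneg_of_fading_negPart {F : ℕ → EuclideanSpace ℝ (Fin 3) → ℝ}
    {g : EuclideanSpace ℝ (Fin 3) → ℝ} (hg : Continuous g)
    (hF : ∀ j, Measurable (F j))
    (hlim : ∀ y, Tendsto (fun j => F j y) atTop (𝓝 (g y)))
    (hfade : ∀ R : ℝ, 0 < R → Tendsto (fun j => ∫⁻ y in ball (0 : EuclideanSpace ℝ (Fin 3)) R,
      ENNReal.ofReal ((min (F j y) 0) ^ 2)) atTop (𝓝 0)) :
    ∀ y, 0 ≤ g y := by
  have hmin : ∀ x : ℝ, (min x 0) ^ 2 = (max (-x) 0) ^ 2 := by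
    intro x
    rcases le_total x 0 with h | h
    · rw [min_eq_left h, max_eq_left (neg_nonneg.2 h), neg_sq]
    · rw [min_eq_right h, max_eq_right (neg_nonpos.2 h)]
  simp_rw [hmin] at hfade
  have h := nonpos_of_fading_posPart (F := fun j y => -F j y) (g := fun y => -g y) hg.neg
    (fun j => (hF j).neg) (fun y => (hlim y).neg) hfade
  intro y
  exact neg_nonpos.1 (h y)

end ZoomFading

end Summit.NavierStokesRegularity.NavierStokesRegularity.Theorems

end
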